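import Literature.NumberTheory.LFunctions.XiHeatRayWindow
import HarnessLib

/-!
# Laplace's method on the heat ray `𝒜_t(σ + iT)`

Fifth file of the in-tree proof of `Literature.NumberTheory.LFunctions.ki_kim_lee_finite`
(Ki–Kim–Lee 2009, Thm. 1.3; reduction in `DeBruijnHXiHeatRay.lean`, pointwise inputs and all
definitions in `XiHeatRayWindow.lean`). Everything here is proved; there are no new definitions.

Split `𝒜_t(σ + iT) = ∫_0^∞ e^{-u²/t} ξ(σ+u+iT) du` at `u = 5` into the initial part
`𝒜^init = ∫_0^5` (where `σ + u` crosses the critical strip) and the main part `𝒜^main = ∫_5^∞`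
(`Literature.NumberTheory.LFunctions.xiHeatRay_eq_init_add_main`). With `u₀ = tℓ_T/2 ≥ 5`,
`K = e^{-u₀²/t} ξ(σ + u₀ + iT)`, the window half-width `Y = u₀ − 5`, `η₂ = η_T + (σ + 2u₀ − 5)/(2T)`,
`η₃ = η₂ + 1/(2T)`, and under the standing hypotheses `Literature.NumberTheory.LFunctions.LaplaceHyp`:

* `Literature.NumberTheory.LFunctions.norm_xiHeatRayMain_ge` — **the main part from below**
  (comparison with `∫_ℝ K e^{-(u−u₀)²/t + iπ(u−u₀)/4} du = K √(πt) e^{-π²t/64}`):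
  `‖𝒜^main(σ)‖ ≥ ‖K‖ m`, `m = √(πt) e^{-π²t/64} − (4t/3) η₂ e^{η₂²t} − 2√(4πt) e^{-Y²/(4t)} − √(2πt) e^{-Y²/(2t)}`;
* `Literature.NumberTheory.LFunctions.norm_xiHeatRayMain_sub_le` — **the main parts at
  `σ₁ ≤ σ₂ ≤ σ₁ + 1`** (two-point control from `σ₁ + u` to `σ₂ + u`):
  `‖𝒜^main(σ₂) − e^{κ_T δ} 𝒜^main(σ₁)‖ ≤ e^{ℓδ} δ ‖K‖ i`, `δ = σ₂ − σ₁`,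
  `i = η₃ e^{η₃ + η₂²t} √(4πt/3) + e^{2η_T + 2 − Y²/(8t)} √(8πt)`;
* `Literature.NumberTheory.LFunctions.norm_xiHeatRayInit_le`,
  `Literature.NumberTheory.LFunctions.norm_xiHeatRayInit_sub_exp_mul_le` — **the initial parts**
  (substitution `v = σ + u`, the Lipschitz bound `|e^{-a} − e^{-b}| ≤ |a − b|` for the Gaussian
  weight, and `|ξ(x + iT)| ≤ 300 T |ξ(σ + 5 + iT)|` on `0 ≤ x ≤ 6`,
  `Literature.NumberTheory.LFunctions.norm_riemannXi_le_of_re_le_six`): with `B = 300T|ξ(σ₁+5+iT)|`,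
  `‖𝒜^init(σ₁)‖ ≤ 5B` and `‖𝒜^init(σ₂) − e^{κ_T δ}𝒜^init(σ₁)‖ ≤ δ e^{ℓδ} B (60/t + 2 + 5e(ℓ+1))`.

These three estimates are combined in `XiHeatRayMonotone.lean`.

## References

* H. Ki, Y.-O. Kim, J. Lee, *On the de Bruijn–Newman constant*, Adv. Math. 222 (2009), Thm. 1.3.
* D. H. J. Polymath, Res. Math. Sci. 6 (2019) 31 (arXiv:1904.12438), §9.
-/

noncomputable section

open Complex Filter Set MeasureTheory
open scoped Real

namespace Literature.NumberTheory.LFunctions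

/-! ## Initial and main parts -/

/-- `𝒜_t(σ + iT) = 𝒜^init + 𝒜^main`. [folklore] -/
theorem xiHeatRay_eq_init_add_main {t : ℝ} (ht : 0 < t) (T σ : ℝ) :
    xiHeatRay t ((σ : ℂ) + T * I) = xiHeatRayInit t T σ + xiHeatRayMain t T σ := by
  rw [xiHeatRay_eq_integral_integrand, xiHeatRayInit, xiHeatRayMain,
    intervalIntegral.integral_interval_add_Ioi (integrable_xiHeatRayIntegrand ht T σ).integrableOn
      (integrable_xiHeatRayIntegrand ht T σ).integrableOn]

/-! ## The Gaussian-phase model and its integral -/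

/-- `‖model(u)‖ = ‖K‖ e^{-(u−u₀)²/t}`. [folklore] -/
theorem norm_xiHeatRayModel (t T σ u : ℝ) :
    ‖xiHeatRayModel t T σ u‖ = ‖xiLaplaceScale t T σ‖ * Real.exp (-((u - xiLaplacePt t T) ^ 2 / t)) := by
  rw [xiHeatRayModel, norm_mul]
  have := norm_cexp_gaussian_phase t (π / 4) (u - xiLaplacePt t T) 0
  simp only [add_zero, Complex.zero_re] at this
  rw [this]

/-- The model is continuous. [folklore] -/
theorem continuous_xiHeatRayModel (t T σ : ℝ) : Continuous (xiHeatRayModel t T σ) := by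
  unfold xiHeatRayModel; fun_prop

/-- The model is integrable over `ℝ` (`t > 0`). [folklore] -/
theorem integrable_xiHeatRayModel {t : ℝ} (ht : 0 < t) (T σ : ℝ) : Integrable (xiHeatRayModel t T σ) := by
  have hg : Integrable fun u : ℝ ↦ ‖xiLaplaceScale t T σ‖ * Real.exp (-((u - xiLaplacePt t T) ^ 2 / t)) :=
    ((integrable_exp_neg_sq_div ht).comp_sub_right (xiLaplacePt t T)).const_mul _
  exact hg.mono' (continuous_xiHeatRayModel t T σ).aestronglyMeasurable
    (Eventually.of_forall fun u ↦ (norm_xiHeatRayModel t T σ u).le)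

/-- **`∫_ℝ K e^{-(u−u₀)²/t + iπ(u−u₀)/4} du = K √(πt) e^{-π²t/64}`.** [folklore] -/
theorem integral_xiHeatRayModel {t : ℝ} (ht : 0 < t) (T σ : ℝ) :
    ∫ u : ℝ, xiHeatRayModel t T σ u =
      xiLaplaceScale t T σ * ((Real.sqrt (π * t) * Real.exp (-(π ^ 2 * t / 64)) : ℝ) : ℂ) := by
  simp only [xiHeatRayModel]
  rw [integral_const_mul]
  congr 1
  have h := integral_gaussian_phase_sub ht (π / 4) (xiLaplacePt t T)
  rw [h]
  congr 3
  ring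

/-- `‖∫_ℝ model‖ = ‖K‖ √(πt) e^{-π²t/64}`. [folklore] -/
theorem norm_integral_xiHeatRayModel {t : ℝ} (ht : 0 < t) (T σ : ℝ) :
    ‖∫ u : ℝ, xiHeatRayModel t T σ u‖ =
      ‖xiLaplaceScale t T σ‖ * (Real.sqrt (π * t) * Real.exp (-(π ^ 2 * t / 64))) := by
  rw [integral_xiHeatRayModel ht, norm_mul, Complex.norm_real, Real.norm_eq_abs,
    abs_of_nonneg (by positivity)]

/-! ## The model fits the integrand on `u > 5` -/

/-- `η₂ ≥ 0` when `T > 0`, `σ ≥ 0`, `u₀ ≥ 5`. [folklore] -/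
theorem xiWindowErr_nonneg {t T σ : ℝ} (hT : 0 < T) (hσ : 0 ≤ σ) (hu₀ : 5 ≤ xiLaplacePt t T) :
    0 ≤ xiWindowErr t T σ := by
  rw [xiWindowErr]
  have := xiRayErr_nonneg hT
  have : 0 ≤ σ + xiLaplacePt t T + (xiLaplacePt t T - 5) := by linarith
  positivity

/-- `b ≥ 0`. [folklore] -/
theorem xiWindowBound_nonneg {t T σ : ℝ} (hT : 0 < T) (hσ : 0 ≤ σ) (hu₀ : 5 ≤ xiLaplacePt t T) (u : ℝ) :
    0 ≤ xiWindowBound t T σ u := by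
  have := xiWindowErr_nonneg hT hσ hu₀
  unfold xiWindowBound
  positivity

/-- `b` is integrable over `ℝ` (`t > 0`). [folklore] -/
theorem integrable_xiWindowBound {t : ℝ} (ht : 0 < t) (T σ : ℝ) : Integrable (xiWindowBound t T σ) := by
  unfold xiWindowBound
  refine Integrable.add ?_ ?_
  · exact ((integrable_abs_mul_exp_neg_sq_div (c := 4 * t / 3) (by positivity)).comp_sub_right
      (xiLaplacePt t T)).const_mul _
  · exact ((integrable_exp_neg_sq_div (c := 4 * t) (by positivity)).comp_sub_right
      (xiLaplacePt t T)).const_mul _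

/-- **`∫_ℝ b = (4t/3) η₂ e^{η₂²t} + 2√(4πt) e^{-Y²/(4t)}`.** [folklore] -/
theorem integral_xiWindowBound {t : ℝ} (ht : 0 < t) (T σ : ℝ) :
    ∫ u : ℝ, xiWindowBound t T σ u =
      xiWindowErr t T σ * Real.exp (xiWindowErr t T σ ^ 2 * t) * (4 * t / 3) +
        2 * Real.exp (-((xiLaplacePt t T - 5) ^ 2 / (4 * t))) * Real.sqrt (π * (4 * t)) := by
  unfold xiWindowBound
  rw [integral_add, integral_const_mul, integral_const_mul]
  · congr 2
    · have := integral_sub_right_eq_self (μ := (volume : Measure ℝ))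
        (fun y : ℝ ↦ |y| * Real.exp (-(y ^ 2 / (4 * t / 3)))) (xiLaplacePt t T)
      rw [this, integral_abs_mul_exp_neg_sq_div (by positivity)]
    · have := integral_sub_right_eq_self (μ := (volume : Measure ℝ))
        (fun y : ℝ ↦ Real.exp (-(y ^ 2 / (4 * t)))) (xiLaplacePt t T)
      rw [this, integral_exp_neg_sq_div (by positivity)]
  · exact ((integrable_abs_mul_exp_neg_sq_div (c := 4 * t / 3) (by positivity)).comp_sub_right
      (xiLaplacePt t T)).const_mul _
  · exact ((integrable_exp_neg_sq_div (c := 4 * t) (by positivity)).comp_sub_right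
      (xiLaplacePt t T)).const_mul _

namespace LaplaceHyp

variable {t T σ : ℝ} (h : LaplaceHyp t T σ)
include h

/-- `T > 0`. [folklore] -/
theorem T_pos : 0 < T := by linarith [h.five_le]

/-- `η_T ≥ 0`. [folklore] -/
theorem rayErr_nonneg : 0 ≤ xiRayErr T := xiRayErr_nonneg h.T_pos

/-- `u₀ ≥ 5`. [folklore] -/
theorem five_le_laplacePt : 5 ≤ xiLaplacePt t T := by
  have := h.window
  have : 0 ≤ 4 * t * (xiRayErr T + 1) := by
    have := h.rayErr_nonneg; have := h.t_pos; positivity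
  linarith

/-- `c = σ + u₀ ≥ 5`. [folklore] -/
theorem five_le_c : 5 ≤ σ + xiLaplacePt t T := by linarith [h.five_le_laplacePt, h.σ_nonneg]

/-- `c ≤ 2T`. [folklore] -/
theorem c_le : σ + xiLaplacePt t T ≤ 2 * T := by linarith [h.c_le']

/-- `Y = u₀ − 5 ≥ 0`. [folklore] -/
theorem Y_nonneg : 0 ≤ xiLaplacePt t T - 5 := by linarith [h.five_le_laplacePt]

/-- `η₂ ≥ 0`. [folklore] -/
theorem windowErr_nonneg : 0 ≤ xiWindowErr t T σ :=
  xiWindowErr_nonneg h.T_pos h.σ_nonneg h.five_le_laplacePt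

end LaplaceHyp

/-- **Pointwise fit on `u > 5`**: `‖e^{-u²/t}ξ(σ+u+iT) − model(u)‖ ≤ ‖K‖ b(u)`
(window lemma for `|u − u₀| ≤ Y`, tail lemma and the triangle inequality beyond). [folklore] -/
theorem norm_xiHeatRayIntegrand_sub_model_le {t T σ u : ℝ} (h : LaplaceHyp t T σ) (hu : 5 < u) :
    ‖xiHeatRayIntegrand t T σ u - xiHeatRayModel t T σ u‖ ≤
      ‖xiLaplaceScale t T σ‖ * xiWindowBound t T σ u := by
  set u₀ := xiLaplacePt t T with hu₀
  set Y := u₀ - 5 with hY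
  set y := u - u₀ with hy
  have ht := h.t_pos
  have hK : 0 ≤ ‖xiLaplaceScale t T σ‖ := norm_nonneg _
  have hη₂ := h.windowErr_nonneg
  have hb1 : 0 ≤ xiWindowErr t T σ * Real.exp (xiWindowErr t T σ ^ 2 * t) *
      (|u - xiLaplacePt t T| * Real.exp (-((u - xiLaplacePt t T) ^ 2 / (4 * t / 3)))) := by positivity
  have hb2 : 0 ≤ 2 * Real.exp (-((xiLaplacePt t T - 5) ^ 2 / (4 * t))) *
      Real.exp (-((u - xiLaplacePt t T) ^ 2 / (4 * t))) := by positivity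
  rcases le_or_gt |y| Y with hwin | htail
  · -- on the window
    have hw := norm_xiHeatRayIntegrand_sub_model_le_of_window ht h.five_le h.σ_nonneg h.Y_nonneg
      h.five_le_c hu hwin
    rw [xiHeatRayModel, xiWindowBound, xiWindowErr]
    calc _ ≤ _ := hw
      _ ≤ _ := by
        rw [mul_add]
        have : (0 : ℝ) ≤ ‖xiLaplaceScale t T σ‖ * (2 * Real.exp (-((xiLaplacePt t T - 5) ^ 2 / (4 * t))) *
            Real.exp (-((u - xiLaplacePt t T) ^ 2 / (4 * t)))) := by positivity
        linarith
  · -- beyond the window: `y > Y` since `u > 5`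
    have hyY : Y < y := by
      rcases le_or_gt 0 y with h0 | h0
      · rwa [abs_of_nonneg h0] at htail
      · exfalso
        rw [abs_of_neg h0] at htail
        have : y = u - u₀ := rfl
        linarith
    have htl := norm_xiHeatRayIntegrand_le_of_tail ht h.five_le h.two_t_le h.five_le_c h.c_le
      (Y := Y) (by linarith [h.window]) hyY.le
    have hY2 : Y ^ 2 ≤ y ^ 2 := pow_le_pow_left₀ h.Y_nonneg hyY.le 2
    have e1 : Real.exp (-(y ^ 2 / (2 * t))) ≤ Real.exp (-(Y ^ 2 / (4 * t))) * Real.exp (-(y ^ 2 / (4 * t))) := by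
      rw [← Real.exp_add]
      apply Real.exp_le_exp.2
      have : y ^ 2 / (2 * t) = y ^ 2 / (4 * t) + y ^ 2 / (4 * t) := by field_simp; ring
      have : Y ^ 2 / (4 * t) ≤ y ^ 2 / (4 * t) := div_le_div_of_nonneg_right hY2 (by positivity)
      linarith
    have e2 : Real.exp (-(y ^ 2 / t)) ≤ Real.exp (-(Y ^ 2 / (4 * t))) * Real.exp (-(y ^ 2 / (4 * t))) := by
      refine le_trans (Real.exp_le_exp.2 ?_) e1
      have : y ^ 2 / (2 * t) ≤ y ^ 2 / t := div_le_div_of_nonneg_left (sq_nonneg y) ht (by linarith)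
      linarith
    calc ‖xiHeatRayIntegrand t T σ u - xiHeatRayModel t T σ u‖
        ≤ ‖xiHeatRayIntegrand t T σ u‖ + ‖xiHeatRayModel t T σ u‖ := norm_sub_le _ _
      _ ≤ ‖xiLaplaceScale t T σ‖ * Real.exp (-(y ^ 2 / (2 * t))) +
          ‖xiLaplaceScale t T σ‖ * Real.exp (-(y ^ 2 / t)) :=
          add_le_add htl (norm_xiHeatRayModel t T σ u).le
      _ ≤ ‖xiLaplaceScale t T σ‖ * (Real.exp (-(Y ^ 2 / (4 * t))) * Real.exp (-(y ^ 2 / (4 * t)))) +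
          ‖xiLaplaceScale t T σ‖ * (Real.exp (-(Y ^ 2 / (4 * t))) * Real.exp (-(y ^ 2 / (4 * t)))) := by
          gcongr
      _ = ‖xiLaplaceScale t T σ‖ * (2 * Real.exp (-((xiLaplacePt t T - 5) ^ 2 / (4 * t))) *
          Real.exp (-((u - xiLaplacePt t T) ^ 2 / (4 * t)))) := by rw [hY, hy]; ring
      _ ≤ ‖xiLaplaceScale t T σ‖ * xiWindowBound t T σ u := by
          rw [xiWindowBound]
          gcongr
          linarith

/-- **The fit, integrated**: `‖∫_5^∞ (e^{-u²/t}ξ(σ+u+iT) − model(u)) du‖ ≤ ‖K‖ ∫_ℝ b`. [folklore] -/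
theorem norm_integral_sub_model_le {t T σ : ℝ} (h : LaplaceHyp t T σ) :
    ‖∫ u in Ioi (5 : ℝ), (xiHeatRayIntegrand t T σ u - xiHeatRayModel t T σ u)‖ ≤
      ‖xiLaplaceScale t T σ‖ * (xiWindowErr t T σ * Real.exp (xiWindowErr t T σ ^ 2 * t) * (4 * t / 3) +
        2 * Real.exp (-((xiLaplacePt t T - 5) ^ 2 / (4 * t))) * Real.sqrt (π * (4 * t))) := by
  have ht := h.t_pos
  have hbi : Integrable fun u ↦ ‖xiLaplaceScale t T σ‖ * xiWindowBound t T σ u :=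
    (integrable_xiWindowBound ht T σ).const_mul _
  calc ‖∫ u in Ioi (5 : ℝ), (xiHeatRayIntegrand t T σ u - xiHeatRayModel t T σ u)‖
      ≤ ∫ u in Ioi (5 : ℝ), ‖xiLaplaceScale t T σ‖ * xiWindowBound t T σ u := by
        refine norm_integral_le_of_norm_le hbi.integrableOn ?_
        exact ae_restrict_of_forall_mem measurableSet_Ioi fun u hu ↦
          norm_xiHeatRayIntegrand_sub_model_le h hu
    _ ≤ ∫ u : ℝ, ‖xiLaplaceScale t T σ‖ * xiWindowBound t T σ u :=
        setIntegral_le_integral hbi (Eventually.of_forall fun u ↦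
          mul_nonneg (norm_nonneg _) (xiWindowBound_nonneg h.T_pos h.σ_nonneg h.five_le_laplacePt u))
    _ = _ := by rw [integral_const_mul, integral_xiWindowBound ht]

/-- **The model's mass left of `5` is negligible**: `‖∫_{u ≤ 5} model‖ ≤ ‖K‖ e^{-Y²/(2t)} √(2πt)`. [folklore] -/
theorem norm_integral_Iic_model_le {t T σ : ℝ} (h : LaplaceHyp t T σ) :
    ‖∫ u in Iic (5 : ℝ), xiHeatRayModel t T σ u‖ ≤
      ‖xiLaplaceScale t T σ‖ * (Real.exp (-((xiLaplacePt t T - 5) ^ 2 / (2 * t))) * Real.sqrt (π * (2 * t))) := by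
  have ht := h.t_pos
  set u₀ := xiLaplacePt t T with hu₀
  set g : ℝ → ℝ := fun u ↦ ‖xiLaplaceScale t T σ‖ * (Real.exp (-((u₀ - 5) ^ 2 / (2 * t))) *
    Real.exp (-((u - u₀) ^ 2 / (2 * t)))) with hg
  have hgi : Integrable g :=
    (((integrable_exp_neg_sq_div (c := 2 * t) (by positivity)).comp_sub_right u₀).const_mul _).const_mul _
  have hg0 : ∀ u, 0 ≤ g u := fun u ↦ by positivity
  calc ‖∫ u in Iic (5 : ℝ), xiHeatRayModel t T σ u‖ ≤ ∫ u in Iic (5 : ℝ), g u := by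
        refine norm_integral_le_of_norm_le hgi.integrableOn ?_
        refine ae_restrict_of_forall_mem measurableSet_Iic fun u hu ↦ ?_
        rw [norm_xiHeatRayModel]
        simp only [hg]
        refine mul_le_mul_of_nonneg_left ?_ (norm_nonneg _)
        rw [← Real.exp_add]
        apply Real.exp_le_exp.2
        have hu5 : u ≤ 5 := hu
        have h1 : (u₀ - 5) ^ 2 ≤ (u - u₀) ^ 2 := by
          have : u₀ - 5 ≤ u₀ - u := by linarith
          calc (u₀ - 5) ^ 2 ≤ (u₀ - u) ^ 2 := pow_le_pow_left₀ h.Y_nonneg this 2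
            _ = (u - u₀) ^ 2 := by ring
        have h2 : (u₀ - 5) ^ 2 / (2 * t) ≤ (u - u₀) ^ 2 / (2 * t) := div_le_div_of_nonneg_right h1 (by positivity)
        have h3 : (u - u₀) ^ 2 / t = (u - u₀) ^ 2 / (2 * t) + (u - u₀) ^ 2 / (2 * t) := by field_simp; ring
        linarith
    _ ≤ ∫ u : ℝ, g u := setIntegral_le_integral hgi (Eventually.of_forall hg0)
    _ = _ := by
        simp only [hg]
        rw [integral_const_mul, integral_const_mul]
        have := integral_sub_right_eq_self (μ := (volume : Measure ℝ))
          (fun y : ℝ ↦ Real.exp (-(y ^ 2 / (2 * t)))) u₀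
        rw [this, integral_exp_neg_sq_div (by positivity)]

/-- **The main part from below** (Laplace's method): under `LaplaceHyp t T σ`,
`‖𝒜^main_t(σ+iT)‖ ≥ ‖K‖ (√(πt) e^{-π²t/64} − (4t/3) η₂ e^{η₂²t} − 2√(4πt) e^{-Y²/(4t)} − √(2πt) e^{-Y²/(2t)})`.
[folklore] -/
theorem norm_xiHeatRayMain_ge {t T σ : ℝ} (h : LaplaceHyp t T σ) :
    ‖xiLaplaceScale t T σ‖ * (Real.sqrt (π * t) * Real.exp (-(π ^ 2 * t / 64)) -
        (xiWindowErr t T σ * Real.exp (xiWindowErr t T σ ^ 2 * t) * (4 * t / 3) +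
          2 * Real.exp (-((xiLaplacePt t T - 5) ^ 2 / (4 * t))) * Real.sqrt (π * (4 * t))) -
        Real.exp (-((xiLaplacePt t T - 5) ^ 2 / (2 * t))) * Real.sqrt (π * (2 * t))) ≤
      ‖xiHeatRayMain t T σ‖ := by
  have ht := h.t_pos
  have hHi := integrable_xiHeatRayIntegrand ht T σ
  have hGi := integrable_xiHeatRayModel ht T σ
  -- `main = ∫_ℝ G − ∫_{Iic 5} G + ∫_{Ioi 5} (H − G)`
  have hsplit : xiHeatRayMain t T σ = (∫ u : ℝ, xiHeatRayModel t T σ u) -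
      (∫ u in Iic (5 : ℝ), xiHeatRayModel t T σ u) +
      ∫ u in Ioi (5 : ℝ), (xiHeatRayIntegrand t T σ u - xiHeatRayModel t T σ u) := by
    rw [xiHeatRayMain, integral_sub hHi.integrableOn hGi.integrableOn,
      ← intervalIntegral.integral_Iic_add_Ioi hGi.integrableOn hGi.integrableOn]
    ring
  have h1 := norm_integral_sub_model_le h
  have h2 := norm_integral_Iic_model_le h
  have h3 := norm_integral_xiHeatRayModel ht T σ
  have key : ‖∫ u : ℝ, xiHeatRayModel t T σ u‖ - ‖∫ u in Iic (5 : ℝ), xiHeatRayModel t T σ u‖ -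
      ‖∫ u in Ioi (5 : ℝ), (xiHeatRayIntegrand t T σ u - xiHeatRayModel t T σ u)‖ ≤
      ‖xiHeatRayMain t T σ‖ := by
    rw [hsplit]
    have := norm_sub_norm_le (∫ u : ℝ, xiHeatRayModel t T σ u) (∫ u in Iic (5 : ℝ), xiHeatRayModel t T σ u)
    have := norm_add_le ((∫ u : ℝ, xiHeatRayModel t T σ u) - (∫ u in Iic (5 : ℝ), xiHeatRayModel t T σ u) +
      ∫ u in Ioi (5 : ℝ), (xiHeatRayIntegrand t T σ u - xiHeatRayModel t T σ u))
      (-(∫ u in Ioi (5 : ℝ), (xiHeatRayIntegrand t T σ u - xiHeatRayModel t T σ u)))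
    rw [add_neg_cancel_right, norm_neg] at this
    linarith
  rw [h3] at key
  nlinarith [norm_nonneg (xiLaplaceScale t T σ)]

end Literature.NumberTheory.LFunctions

namespace Literature.NumberTheory.LFunctions

/-! ## `x e^x` bookkeeping -/

/-- `x e^{x} ≤ e^{2x}` for `x ≥ 0`. [folklore] -/
theorem mul_exp_le_exp_two_mul (x : ℝ) : x * Real.exp x ≤ Real.exp (2 * x) := by
  have h1 : x ≤ Real.exp x := by linarith [Real.add_one_le_exp x]
  calc x * Real.exp x ≤ Real.exp x * Real.exp x := by gcongr
    _ = Real.exp (2 * x) := by rw [← Real.exp_add]; congr 1; ring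

/-- `x ↦ x e^x` is monotone on `[0, ∞)`. [folklore] -/
theorem mul_exp_le_mul_exp {x y : ℝ} (hx : 0 ≤ x) (hxy : x ≤ y) : x * Real.exp x ≤ y * Real.exp y := by
  have hy : 0 ≤ y := hx.trans hxy
  gcongr

/-! ## The main parts: pointwise -/

/-- `η₃ ≥ 0`. [folklore] -/
theorem LaplaceHyp.windowErr'_nonneg {t T σ : ℝ} (h : LaplaceHyp t T σ) : 0 ≤ xiWindowErr' t T σ := by
  rw [xiWindowErr']
  have := h.rayErr_nonneg
  have := h.five_le_laplacePt
  have := h.σ_nonneg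
  have := h.T_pos
  have : 0 ≤ σ + xiLaplacePt t T + (xiLaplacePt t T - 5) + 1 := by linarith
  positivity

/-- `b₂ ≥ 0`. [folklore] -/
theorem LaplaceHyp.xiDiffBound_nonneg {t T σ : ℝ} (h : LaplaceHyp t T σ) (u : ℝ) : 0 ≤ xiDiffBound t T σ u := by
  have := h.windowErr'_nonneg
  unfold xiDiffBound
  positivity

/-- `b₂` is integrable. [folklore] -/
theorem integrable_xiDiffBound {t : ℝ} (ht : 0 < t) (T σ : ℝ) : Integrable (xiDiffBound t T σ) := by
  unfold xiDiffBound
  refine Integrable.add ?_ ?_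
  · exact ((integrable_exp_neg_sq_div (c := 4 * t / 3) (by positivity)).comp_sub_right
      (xiLaplacePt t T)).const_mul _
  · exact ((integrable_exp_neg_sq_div (c := 8 * t) (by positivity)).comp_sub_right
      (xiLaplacePt t T)).const_mul _

/-- **`∫_ℝ b₂ = η₃ e^{η₃ + η₂²t} √(4πt/3) + e^{2η_T + 2 − Y²/(8t)} √(8πt)`.** [folklore] -/
theorem integral_xiDiffBound {t : ℝ} (ht : 0 < t) (T σ : ℝ) :
    ∫ u : ℝ, xiDiffBound t T σ u =
      xiWindowErr' t T σ * Real.exp (xiWindowErr' t T σ + xiWindowErr t T σ ^ 2 * t) *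
          Real.sqrt (π * (4 * t / 3)) +
        Real.exp (2 * xiRayErr T + 2 - (xiLaplacePt t T - 5) ^ 2 / (8 * t)) * Real.sqrt (π * (8 * t)) := by
  unfold xiDiffBound
  rw [integral_add, integral_const_mul, integral_const_mul]
  · congr 2
    · have := integral_sub_right_eq_self (μ := (volume : Measure ℝ))
        (fun y : ℝ ↦ Real.exp (-(y ^ 2 / (4 * t / 3)))) (xiLaplacePt t T)
      rw [this, integral_exp_neg_sq_div (by positivity)]
    · have := integral_sub_right_eq_self (μ := (volume : Measure ℝ))
        (fun y : ℝ ↦ Real.exp (-(y ^ 2 / (8 * t)))) (xiLaplacePt t T)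
      rw [this, integral_exp_neg_sq_div (by positivity)]
  · exact ((integrable_exp_neg_sq_div (c := 4 * t / 3) (by positivity)).comp_sub_right
      (xiLaplacePt t T)).const_mul _
  · exact ((integrable_exp_neg_sq_div (c := 8 * t) (by positivity)).comp_sub_right
      (xiLaplacePt t T)).const_mul _

/-- **Weighted size of the integrand on `u > 5`**: under `LaplaceHyp t T σ`, with
`η_u = η_T + (σ + u + 1)/(2T)`, `‖e^{-u²/t}ξ(σ+u+iT)‖ · η_u e^{η_u} ≤ ‖K‖ b₂(u)`. [folklore] -/
theorem norm_xiHeatRayIntegrand_mul_weight_le {t T σ u : ℝ} (h : LaplaceHyp t T σ) (hu : 5 < u) :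
    ‖xiHeatRayIntegrand t T σ u‖ * ((xiRayErr T + (σ + u + 1) / (2 * T)) *
        Real.exp (xiRayErr T + (σ + u + 1) / (2 * T))) ≤
      ‖xiLaplaceScale t T σ‖ * xiDiffBound t T σ u := by
  set u₀ := xiLaplacePt t T with hu₀
  set Y := u₀ - 5 with hY
  set y := u - u₀ with hy
  set ηu := xiRayErr T + (σ + u + 1) / (2 * T) with hηu
  have ht := h.t_pos
  have hT := h.T_pos
  have hη := h.rayErr_nonneg
  have hK : 0 ≤ ‖xiLaplaceScale t T σ‖ := norm_nonneg _
  have hηu0 : 0 ≤ ηu := by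
    have : 0 ≤ σ + u + 1 := by linarith [h.σ_nonneg]
    positivity
  have hη₃ := h.windowErr'_nonneg
  have hterm1 : 0 ≤ xiWindowErr' t T σ * Real.exp (xiWindowErr' t T σ + xiWindowErr t T σ ^ 2 * t) *
      Real.exp (-((u - xiLaplacePt t T) ^ 2 / (4 * t / 3))) := by positivity
  have hterm2 : 0 ≤ Real.exp (2 * xiRayErr T + 2 - (xiLaplacePt t T - 5) ^ 2 / (8 * t)) *
      Real.exp (-((u - xiLaplacePt t T) ^ 2 / (8 * t))) := by positivity
  rcases le_or_gt |y| Y with hwin | htail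
  · -- window: `η_u ≤ η₃`, `‖H‖ ≤ ‖K‖ e^{η₂²t} e^{-3y²/4t}`
    have hH := norm_xiHeatRayIntegrand_le_of_window ht h.five_le h.σ_nonneg h.Y_nonneg h.five_le_c hu hwin
    have hηu3 : ηu ≤ xiWindowErr' t T σ := by
      rw [hηu, xiWindowErr']
      have hyle : y ≤ Y := (le_abs_self y).trans hwin
      have : σ + u + 1 ≤ σ + xiLaplacePt t T + (xiLaplacePt t T - 5) + 1 := by
        have : u = u₀ + y := by rw [hy]; ring
        rw [this]; linarith
      have := div_le_div_of_nonneg_right this (by positivity : (0:ℝ) ≤ 2 * T)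
      linarith
    have hw : ηu * Real.exp ηu ≤ xiWindowErr' t T σ * Real.exp (xiWindowErr' t T σ) :=
      mul_exp_le_mul_exp hηu0 hηu3
    calc ‖xiHeatRayIntegrand t T σ u‖ * (ηu * Real.exp ηu)
        ≤ ‖xiLaplaceScale t T σ‖ * (Real.exp (xiWindowErr t T σ ^ 2 * t) *
            Real.exp (-((u - xiLaplacePt t T) ^ 2 / (4 * t / 3)))) *
            (xiWindowErr' t T σ * Real.exp (xiWindowErr' t T σ)) := by
          apply mul_le_mul hH hw (by positivity) (by positivity)
      _ = ‖xiLaplaceScale t T σ‖ * (xiWindowErr' t T σ *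
            Real.exp (xiWindowErr' t T σ + xiWindowErr t T σ ^ 2 * t) *
            Real.exp (-((u - xiLaplacePt t T) ^ 2 / (4 * t / 3)))) := by
          rw [Real.exp_add]; ring
      _ ≤ ‖xiLaplaceScale t T σ‖ * xiDiffBound t T σ u := by
          rw [xiDiffBound]
          gcongr
          linarith
  · -- tail: `y > Y`
    have hyY : Y < y := by
      rcases le_or_gt 0 y with h0 | h0
      · rwa [abs_of_nonneg h0] at htail
      · exfalso
        rw [abs_of_neg h0] at htail
        have : y = u - u₀ := rfl
        linarith
    have hY4 : 4 * t * (xiRayErr T + 1) ≤ Y := by linarith [h.window]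
    have hH := norm_xiHeatRayIntegrand_le_of_tail ht h.five_le h.two_t_le h.five_le_c h.c_le hY4 hyY.le
    have hy4t : 4 * t ≤ y := by
      have : 4 * t ≤ 4 * t * (xiRayErr T + 1) := by nlinarith
      linarith
    have hy0 : 0 ≤ y := by linarith
    -- `η_u e^{η_u} ≤ e^{2η_u} ≤ e^{2η + 2} e^{y²/(4t)}`
    have h1 : ηu * Real.exp ηu ≤ Real.exp (2 * ηu) := mul_exp_le_exp_two_mul ηu
    have h2 : 2 * ηu ≤ 2 * xiRayErr T + 2 + y ^ 2 / (4 * t) := by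
      rw [hηu]
      have hu' : σ + u + 1 = (σ + u₀ + 1) + y := by rw [hy]; ring
      have hc : (σ + u₀ + 1) / (2 * T) ≤ 1 := by
        rw [div_le_one (by positivity)]; exact h.c_le'
      have hyT : y / (2 * T) ≤ y ^ 2 / (8 * t) := by
        rw [div_le_div_iff₀ (by positivity) (by positivity)]
        have : 4 * t * 1 ≤ y * T := mul_le_mul hy4t (by linarith [h.five_le]) zero_le_one hy0
        nlinarith
      have e : (σ + u + 1) / (2 * T) = (σ + u₀ + 1) / (2 * T) + y / (2 * T) := by
        rw [hu']; ring
      rw [e]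
      have : y ^ 2 / (8 * t) * 2 = y ^ 2 / (4 * t) := by field_simp; ring
      nlinarith
    have h3 : ηu * Real.exp ηu ≤ Real.exp (2 * xiRayErr T + 2) * Real.exp (y ^ 2 / (4 * t)) := by
      rw [← Real.exp_add]
      exact h1.trans (Real.exp_le_exp.2 h2)
    have hY2 : Y ^ 2 ≤ y ^ 2 := pow_le_pow_left₀ h.Y_nonneg hyY.le 2
    have h4 : Real.exp (-(y ^ 2 / (2 * t))) * Real.exp (y ^ 2 / (4 * t)) ≤
        Real.exp (-(Y ^ 2 / (8 * t))) * Real.exp (-(y ^ 2 / (8 * t))) := by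
      rw [← Real.exp_add, ← Real.exp_add]
      apply Real.exp_le_exp.2
      have e1 : -(y ^ 2 / (2 * t)) + y ^ 2 / (4 * t) = -(y ^ 2 / (8 * t)) - y ^ 2 / (8 * t) := by
        field_simp; ring
      have : Y ^ 2 / (8 * t) ≤ y ^ 2 / (8 * t) := div_le_div_of_nonneg_right hY2 (by positivity)
      linarith
    calc ‖xiHeatRayIntegrand t T σ u‖ * (ηu * Real.exp ηu)
        ≤ ‖xiLaplaceScale t T σ‖ * Real.exp (-(y ^ 2 / (2 * t))) *
            (Real.exp (2 * xiRayErr T + 2) * Real.exp (y ^ 2 / (4 * t))) :=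
          mul_le_mul hH h3 (by positivity) (by positivity)
      _ = ‖xiLaplaceScale t T σ‖ * Real.exp (2 * xiRayErr T + 2) *
            (Real.exp (-(y ^ 2 / (2 * t))) * Real.exp (y ^ 2 / (4 * t))) := by ring
      _ ≤ ‖xiLaplaceScale t T σ‖ * Real.exp (2 * xiRayErr T + 2) *
            (Real.exp (-(Y ^ 2 / (8 * t))) * Real.exp (-(y ^ 2 / (8 * t)))) := by gcongr
      _ = ‖xiLaplaceScale t T σ‖ * (Real.exp (2 * xiRayErr T + 2 - Y ^ 2 / (8 * t)) *
            Real.exp (-(y ^ 2 / (8 * t)))) := by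
          have e5 : Real.exp (2 * xiRayErr T + 2) * Real.exp (-(Y ^ 2 / (8 * t))) =
              Real.exp (2 * xiRayErr T + 2 - Y ^ 2 / (8 * t)) := by
            rw [← Real.exp_add]; ring_nf
          rw [← e5]; ring
      _ ≤ ‖xiLaplaceScale t T σ‖ * xiDiffBound t T σ u := by
          rw [xiDiffBound, ← hu₀, ← hY, ← hy]
          gcongr
          linarith

/-- **Pointwise difference of the integrands at `σ₁ ≤ σ₂ ≤ σ₁ + 1`** (two-point control from
`σ₁ + u` to `σ₂ + u`, `u > 5`): `‖H_{σ₂}(u) − e^{κ_T δ} H_{σ₁}(u)‖ ≤ e^{ℓδ} δ ‖K‖ b₂(u)`, `δ = σ₂ − σ₁`.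
[folklore] -/
theorem norm_xiHeatRayIntegrand_sub_exp_mul_le {t T σ₁ σ₂ u : ℝ} (h : LaplaceHyp t T σ₁)
    (h12 : σ₁ ≤ σ₂) (hδ : σ₂ - σ₁ ≤ 1) (hu : 5 < u) :
    ‖xiHeatRayIntegrand t T σ₂ u - cexp (xiLogDerivModel T * (σ₂ - σ₁ : ℝ)) * xiHeatRayIntegrand t T σ₁ u‖ ≤
      Real.exp (xiRayEll T * (σ₂ - σ₁)) * (σ₂ - σ₁) * (‖xiLaplaceScale t T σ₁‖ * xiDiffBound t T σ₁ u) := by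
  set δ := σ₂ - σ₁ with hδ'
  have hδ0 : 0 ≤ δ := by linarith
  have hT := h.T_pos
  obtain ⟨ρ, hρ, heq⟩ := riemannXi_horizontal_two_point (T := T) (v₀ := σ₁ + u) (a := δ) h.five_le
    (by linarith [h.σ_nonneg]) hδ0
  set ηu := xiRayErr T + (σ₁ + u + 1) / (2 * T) with hηu
  have hηu0 : 0 ≤ ηu := by
    have := h.rayErr_nonneg; have : 0 ≤ σ₁ + u + 1 := by linarith [h.σ_nonneg]
    positivity
  have hρ' : ‖ρ‖ ≤ δ * ηu := by
    refine hρ.trans (mul_le_mul_of_nonneg_left ?_ hδ0)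
    rw [hηu]
    have : (σ₁ + u + δ) / (2 * T) ≤ (σ₁ + u + 1) / (2 * T) := div_le_div_of_nonneg_right (by linarith) (by positivity)
    linarith
  -- rewrite the difference as `e^{κδ} H₁ (e^ρ − 1)`
  have hH2 : xiHeatRayIntegrand t T σ₂ u =
      cexp (xiLogDerivModel T * (δ : ℝ)) * xiHeatRayIntegrand t T σ₁ u * cexp ρ := by
    rw [xiHeatRayIntegrand, xiHeatRayIntegrand, ray_point_eq, ray_point_eq,
      show σ₂ + u = σ₁ + u + δ by rw [hδ']; ring, heq, Complex.exp_add]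
    ring
  have hdiff : xiHeatRayIntegrand t T σ₂ u - cexp (xiLogDerivModel T * (δ : ℝ)) * xiHeatRayIntegrand t T σ₁ u =
      cexp (xiLogDerivModel T * (δ : ℝ)) * xiHeatRayIntegrand t T σ₁ u * (cexp ρ - 1) := by
    rw [hH2]; ring
  have hnorm_exp : ‖cexp (xiLogDerivModel T * (δ : ℝ))‖ = Real.exp (xiRayEll T * δ) := by
    rw [Complex.norm_exp]
    congr 1
    simp [xiLogDerivModel_eq_ell]
  rw [hdiff, norm_mul, norm_mul, hnorm_exp]
  have h1 : ‖cexp ρ - 1‖ ≤ δ * (ηu * Real.exp ηu) := by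
    refine (norm_cexp_sub_one_le_mul_exp ρ).trans ?_
    have hδη : δ * ηu ≤ ηu := by nlinarith
    calc ‖ρ‖ * Real.exp ‖ρ‖ ≤ (δ * ηu) * Real.exp (δ * ηu) := mul_exp_le_mul_exp (norm_nonneg _) hρ'
      _ ≤ (δ * ηu) * Real.exp ηu := by gcongr
      _ = δ * (ηu * Real.exp ηu) := by ring
  have h2 := norm_xiHeatRayIntegrand_mul_weight_le h hu
  calc Real.exp (xiRayEll T * δ) * ‖xiHeatRayIntegrand t T σ₁ u‖ * ‖cexp ρ - 1‖
      ≤ Real.exp (xiRayEll T * δ) * ‖xiHeatRayIntegrand t T σ₁ u‖ * (δ * (ηu * Real.exp ηu)) := by gcongr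
    _ = Real.exp (xiRayEll T * δ) * δ * (‖xiHeatRayIntegrand t T σ₁ u‖ * (ηu * Real.exp ηu)) := by ring
    _ ≤ Real.exp (xiRayEll T * δ) * δ * (‖xiLaplaceScale t T σ₁‖ * xiDiffBound t T σ₁ u) := by gcongr

/-- **The main parts**: `‖𝒜^main(σ₂) − e^{κδ} 𝒜^main(σ₁)‖ ≤ e^{ℓδ} δ ‖K‖ ∫_ℝ b₂`. [folklore] -/
theorem norm_xiHeatRayMain_sub_le {t T σ₁ σ₂ : ℝ} (h : LaplaceHyp t T σ₁) (h12 : σ₁ ≤ σ₂) (hδ : σ₂ - σ₁ ≤ 1) :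
    ‖xiHeatRayMain t T σ₂ - cexp (xiLogDerivModel T * (σ₂ - σ₁ : ℝ)) * xiHeatRayMain t T σ₁‖ ≤
      Real.exp (xiRayEll T * (σ₂ - σ₁)) * (σ₂ - σ₁) * (‖xiLaplaceScale t T σ₁‖ *
        (xiWindowErr' t T σ₁ * Real.exp (xiWindowErr' t T σ₁ + xiWindowErr t T σ₁ ^ 2 * t) *
            Real.sqrt (π * (4 * t / 3)) +
          Real.exp (2 * xiRayErr T + 2 - (xiLaplacePt t T - 5) ^ 2 / (8 * t)) * Real.sqrt (π * (8 * t)))) := by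
  have ht := h.t_pos
  set C := Real.exp (xiRayEll T * (σ₂ - σ₁)) * (σ₂ - σ₁) with hC
  have hC0 : 0 ≤ C := by
    have : 0 ≤ σ₂ - σ₁ := by linarith
    positivity
  have hbi : Integrable fun u ↦ C * (‖xiLaplaceScale t T σ₁‖ * xiDiffBound t T σ₁ u) :=
    ((integrable_xiDiffBound ht T σ₁).const_mul _).const_mul _
  have hsub : xiHeatRayMain t T σ₂ - cexp (xiLogDerivModel T * (σ₂ - σ₁ : ℝ)) * xiHeatRayMain t T σ₁ =
      ∫ u in Ioi (5 : ℝ), (xiHeatRayIntegrand t T σ₂ u -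
        cexp (xiLogDerivModel T * (σ₂ - σ₁ : ℝ)) * xiHeatRayIntegrand t T σ₁ u) := by
    rw [xiHeatRayMain, xiHeatRayMain, ← integral_const_mul, ← integral_sub]
    · exact (integrable_xiHeatRayIntegrand ht T σ₂).integrableOn
    · exact ((integrable_xiHeatRayIntegrand ht T σ₁).const_mul _).integrableOn
  rw [hsub]
  calc _ ≤ ∫ u in Ioi (5 : ℝ), C * (‖xiLaplaceScale t T σ₁‖ * xiDiffBound t T σ₁ u) := by
        refine norm_integral_le_of_norm_le hbi.integrableOn ?_
        exact ae_restrict_of_forall_mem measurableSet_Ioi fun u hu ↦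
          norm_xiHeatRayIntegrand_sub_exp_mul_le h h12 hδ hu
    _ ≤ ∫ u : ℝ, C * (‖xiLaplaceScale t T σ₁‖ * xiDiffBound t T σ₁ u) :=
        setIntegral_le_integral hbi (Eventually.of_forall fun u ↦
          mul_nonneg hC0 (mul_nonneg (norm_nonneg _) (h.xiDiffBound_nonneg u)))
    _ = _ := by rw [integral_const_mul, integral_const_mul, integral_xiDiffBound ht]

end Literature.NumberTheory.LFunctions

namespace Literature.NumberTheory.LFunctions

/-! ## The initial part after the substitution `v = σ + u` -/

/-- `g_σ` is continuous. [folklore] -/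
theorem continuous_xiInitIntegrand (t T σ : ℝ) : Continuous (xiInitIntegrand t T σ) := by
  have : Continuous riemannXi := differentiable_riemannXi.continuous
  unfold xiInitIntegrand
  fun_prop

/-- **Substitution**: `𝒜^init_t(σ + iT) = ∫_σ^{σ+5} e^{-(v−σ)²/t} ξ(v + iT) dv`. [folklore] -/
theorem xiHeatRayInit_eq_integral (t T σ : ℝ) :
    xiHeatRayInit t T σ = ∫ v in σ..σ + 5, xiInitIntegrand t T σ v := by
  rw [xiHeatRayInit]
  have h := intervalIntegral.integral_comp_add_right (a := 0) (b := 5) (xiInitIntegrand t T σ) σ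
  rw [zero_add, show (5 : ℝ) + σ = σ + 5 by ring] at h
  rw [← h]
  refine intervalIntegral.integral_congr fun u _ ↦ ?_
  simp only [xiHeatRayIntegrand, xiInitIntegrand, add_sub_cancel_right]
  congr 1
  push_cast; ring_nf

/-- `B ≥ 0` for `T ≥ 0`. [folklore] -/
theorem xiStripScale_nonneg {T : ℝ} (hT : 0 ≤ T) (σ : ℝ) : 0 ≤ xiStripScale T σ := by
  unfold xiStripScale; positivity

/-- **`‖g_{σ'}(v)‖ ≤ B` for `v ∈ [0, 6]`** (`T ≥ 100`, `σ ∈ [0,1]` the base abscissa of `B`, any `σ'`).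
[folklore] -/
theorem norm_xiInitIntegrand_le {t T σ σ' v : ℝ} (ht : 0 < t) (hT : 100 ≤ T) (hσ : σ ∈ Icc (0:ℝ) 1)
    (hv : v ∈ Icc (0:ℝ) 6) : ‖xiInitIntegrand t T σ' v‖ ≤ xiStripScale T σ := by
  rw [xiInitIntegrand, norm_mul, Complex.norm_real, Real.norm_eq_abs, abs_of_pos (Real.exp_pos _),
    xiStripScale]
  have h1 : Real.exp (-(v - σ') ^ 2 / t) ≤ 1 := by
    rw [Real.exp_le_one_iff, neg_div]
    exact neg_nonpos.2 (div_nonneg (sq_nonneg _) ht.le)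
  have h2 := norm_riemannXi_le_of_re_le_six hT hσ hv
  calc Real.exp (-(v - σ') ^ 2 / t) * ‖riemannXi ((v : ℂ) + T * I)‖
      ≤ 1 * (300 * T * ‖riemannXi (((σ + 5 : ℝ) : ℂ) + T * I)‖) :=
        mul_le_mul h1 h2 (norm_nonneg _) zero_le_one
    _ = _ := one_mul _

/-- **`‖𝒜^init_t(σ + iT)‖ ≤ 5B`** (`T ≥ 100`, `σ ∈ [0,1]`). [folklore] -/
theorem norm_xiHeatRayInit_le {t T σ : ℝ} (ht : 0 < t) (hT : 100 ≤ T) (hσ : σ ∈ Icc (0:ℝ) 1) :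
    ‖xiHeatRayInit t T σ‖ ≤ 5 * xiStripScale T σ := by
  rw [xiHeatRayInit_eq_integral]
  have h : ∀ v ∈ Set.uIoc σ (σ + 5), ‖xiInitIntegrand t T σ v‖ ≤ xiStripScale T σ := by
    intro v hv
    rw [Set.uIoc_of_le (by linarith)] at hv
    exact norm_xiInitIntegrand_le ht hT hσ ⟨by linarith [hv.1, hσ.1], by linarith [hv.2, hσ.2]⟩
  calc _ ≤ xiStripScale T σ * |σ + 5 - σ| := intervalIntegral.norm_integral_le_of_norm_le_const h
    _ = 5 * xiStripScale T σ := by rw [show σ + 5 - σ = 5 by ring, abs_of_pos (by norm_num)]; ring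

/-- **Lipschitz dependence of the Gaussian weight on `σ`**: for `v ∈ [0,6]`, `σ₁, σ₂ ∈ [0,1]`,
`‖g_{σ₂}(v) − g_{σ₁}(v)‖ ≤ (12 |σ₂ − σ₁| / t) B`. [folklore] -/
theorem norm_xiInitIntegrand_sub_le {t T σ₁ σ₂ v : ℝ} (ht : 0 < t) (hT : 100 ≤ T)
    (hσ₁ : σ₁ ∈ Icc (0:ℝ) 1) (hσ₂ : σ₂ ∈ Icc (0:ℝ) 1) (hv : v ∈ Icc (0:ℝ) 6) :
    ‖xiInitIntegrand t T σ₂ v - xiInitIntegrand t T σ₁ v‖ ≤ 12 * |σ₂ - σ₁| / t * xiStripScale T σ₁ := by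
  have hsub : xiInitIntegrand t T σ₂ v - xiInitIntegrand t T σ₁ v =
      ((Real.exp (-(v - σ₂) ^ 2 / t) - Real.exp (-(v - σ₁) ^ 2 / t) : ℝ) : ℂ) *
        riemannXi ((v : ℂ) + T * I) := by
    simp only [xiInitIntegrand]; push_cast; ring
  rw [hsub, norm_mul, Complex.norm_real, Real.norm_eq_abs, xiStripScale]
  have h1 : |Real.exp (-(v - σ₂) ^ 2 / t) - Real.exp (-(v - σ₁) ^ 2 / t)| ≤ 12 * |σ₂ - σ₁| / t := by
    rw [neg_div, neg_div]
    refine (abs_exp_neg_sub_exp_neg_le (by positivity) (by positivity)).trans ?_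
    rw [← sub_div, abs_div, abs_of_pos ht]
    refine div_le_div_of_nonneg_right ?_ ht.le
    have e : (v - σ₂) ^ 2 - (v - σ₁) ^ 2 = (σ₂ - σ₁) * (σ₁ + σ₂ - 2 * v) := by ring
    rw [e, abs_mul, mul_comm]
    refine mul_le_mul_of_nonneg_right ?_ (abs_nonneg _)
    rw [abs_le]
    constructor <;> linarith [hσ₁.1, hσ₁.2, hσ₂.1, hσ₂.2, hv.1, hv.2]
  have h2 := norm_riemannXi_le_of_re_le_six hT hσ₁ hv
  calc _ ≤ 12 * |σ₂ - σ₁| / t * (300 * T * ‖riemannXi (((σ₁ + 5 : ℝ) : ℂ) + T * I)‖) :=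
        mul_le_mul h1 h2 (norm_nonneg _) (by positivity)
    _ = _ := rfl

/-- **The initial parts are Lipschitz in `σ`**: for `T ≥ 100`, `0 ≤ σ₁ ≤ σ₂ ≤ 1`,
`‖𝒜^init(σ₂) − 𝒜^init(σ₁)‖ ≤ (σ₂ − σ₁)(60/t + 2) B`. [folklore] -/
theorem norm_xiHeatRayInit_sub_le {t T σ₁ σ₂ : ℝ} (ht : 0 < t) (hT : 100 ≤ T) (h0 : 0 ≤ σ₁)
    (h12 : σ₁ ≤ σ₂) (h1 : σ₂ ≤ 1) :
    ‖xiHeatRayInit t T σ₂ - xiHeatRayInit t T σ₁‖ ≤ (σ₂ - σ₁) * (60 / t + 2) * xiStripScale T σ₁ := by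
  have hσ₁ : σ₁ ∈ Icc (0:ℝ) 1 := ⟨h0, by linarith⟩
  have hσ₂ : σ₂ ∈ Icc (0:ℝ) 1 := ⟨by linarith, h1⟩
  set δ := σ₂ - σ₁ with hδ
  have hδ0 : 0 ≤ δ := by linarith
  set B := xiStripScale T σ₁ with hB
  have hB0 : 0 ≤ B := xiStripScale_nonneg (by linarith) σ₁
  set g₁ := xiInitIntegrand t T σ₁ with hg₁
  set g₂ := xiInitIntegrand t T σ₂ with hg₂
  have hi₁ : ∀ a b : ℝ, IntervalIntegrable g₁ volume a b := fun a b ↦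
    (continuous_xiInitIntegrand t T σ₁).intervalIntegrable a b
  have hi₂ : ∀ a b : ℝ, IntervalIntegrable g₂ volume a b := fun a b ↦
    (continuous_xiInitIntegrand t T σ₂).intervalIntegrable a b
  rw [xiHeatRayInit_eq_integral, xiHeatRayInit_eq_integral]
  -- split both integrals at `σ₂` and `σ₁ + 5`
  have s1 : ∫ v in σ₁..σ₁ + 5, g₁ v = (∫ v in σ₁..σ₂, g₁ v) + ∫ v in σ₂..σ₁ + 5, g₁ v :=
    (intervalIntegral.integral_add_adjacent_intervals (hi₁ _ _) (hi₁ _ _)).symm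
  have s2 : ∫ v in σ₂..σ₂ + 5, g₂ v = (∫ v in σ₂..σ₁ + 5, g₂ v) + ∫ v in σ₁ + 5..σ₂ + 5, g₂ v :=
    (intervalIntegral.integral_add_adjacent_intervals (hi₂ _ _) (hi₂ _ _)).symm
  have s3 : (∫ v in σ₂..σ₁ + 5, g₂ v) - ∫ v in σ₂..σ₁ + 5, g₁ v = ∫ v in σ₂..σ₁ + 5, (g₂ v - g₁ v) :=
    (intervalIntegral.integral_sub (hi₂ _ _) (hi₁ _ _)).symm
  have key : (∫ v in σ₂..σ₂ + 5, g₂ v) - ∫ v in σ₁..σ₁ + 5, g₁ v =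
      (∫ v in σ₂..σ₁ + 5, (g₂ v - g₁ v)) + (∫ v in σ₁ + 5..σ₂ + 5, g₂ v) - ∫ v in σ₁..σ₂, g₁ v := by
    rw [s1, s2, ← s3]; ring
  rw [key]
  -- the three bounds
  have b1 : ‖∫ v in σ₂..σ₁ + 5, (g₂ v - g₁ v)‖ ≤ 12 * δ / t * B * 5 := by
    have h : ∀ v ∈ Set.uIoc σ₂ (σ₁ + 5), ‖g₂ v - g₁ v‖ ≤ 12 * δ / t * B := by
      intro v hv
      rw [Set.uIoc_of_le (by linarith)] at hv
      have := norm_xiInitIntegrand_sub_le ht hT hσ₁ hσ₂ (v := v) ⟨by linarith [hv.1], by linarith [hv.2]⟩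
      rwa [abs_of_nonneg hδ0] at this
    calc _ ≤ 12 * δ / t * B * |σ₁ + 5 - σ₂| := intervalIntegral.norm_integral_le_of_norm_le_const h
      _ ≤ 12 * δ / t * B * 5 := by
          refine mul_le_mul_of_nonneg_left ?_ (by positivity)
          rw [abs_le]; constructor <;> linarith
  have b2 : ‖∫ v in σ₁ + 5..σ₂ + 5, g₂ v‖ ≤ B * δ := by
    have h : ∀ v ∈ Set.uIoc (σ₁ + 5) (σ₂ + 5), ‖g₂ v‖ ≤ B := by
      intro v hv
      rw [Set.uIoc_of_le (by linarith)] at hv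
      exact norm_xiInitIntegrand_le ht hT hσ₁ ⟨by linarith [hv.1], by linarith [hv.2]⟩
    calc _ ≤ B * |σ₂ + 5 - (σ₁ + 5)| := intervalIntegral.norm_integral_le_of_norm_le_const h
      _ = B * δ := by rw [show σ₂ + 5 - (σ₁ + 5) = δ by rw [hδ]; ring, abs_of_nonneg hδ0]
  have b3 : ‖∫ v in σ₁..σ₂, g₁ v‖ ≤ B * δ := by
    have h : ∀ v ∈ Set.uIoc σ₁ σ₂, ‖g₁ v‖ ≤ B := by
      intro v hv
      rw [Set.uIoc_of_le h12] at hv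
      exact norm_xiInitIntegrand_le ht hT hσ₁ ⟨by linarith [hv.1], by linarith [hv.2]⟩
    calc _ ≤ B * |σ₂ - σ₁| := intervalIntegral.norm_integral_le_of_norm_le_const h
      _ = B * δ := by rw [abs_of_nonneg hδ0]
  calc ‖(∫ v in σ₂..σ₁ + 5, (g₂ v - g₁ v)) + (∫ v in σ₁ + 5..σ₂ + 5, g₂ v) - ∫ v in σ₁..σ₂, g₁ v‖
      ≤ ‖∫ v in σ₂..σ₁ + 5, (g₂ v - g₁ v)‖ + ‖∫ v in σ₁ + 5..σ₂ + 5, g₂ v‖ + ‖∫ v in σ₁..σ₂, g₁ v‖ := by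
        refine (norm_sub_le _ _).trans ?_
        gcongr
        exact norm_add_le _ _
    _ ≤ 12 * δ / t * B * 5 + B * δ + B * δ := by gcongr
    _ = δ * (60 / t + 2) * B := by field_simp; ring

/-- **The initial parts against the model growth**: for `T ≥ 100`, `0 ≤ σ₁ ≤ σ₂ ≤ 1`, `δ = σ₂ − σ₁`,
`‖𝒜^init(σ₂) − e^{κ_T δ} 𝒜^init(σ₁)‖ ≤ δ e^{ℓδ} B (60/t + 2 + 5e(ℓ + 1))`. [folklore] -/
theorem norm_xiHeatRayInit_sub_exp_mul_le {t T σ₁ σ₂ : ℝ} (ht : 0 < t) (hT : 100 ≤ T) (h0 : 0 ≤ σ₁)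
    (h12 : σ₁ ≤ σ₂) (h1 : σ₂ ≤ 1) :
    ‖xiHeatRayInit t T σ₂ - cexp (xiLogDerivModel T * (σ₂ - σ₁ : ℝ)) * xiHeatRayInit t T σ₁‖ ≤
      (σ₂ - σ₁) * Real.exp (xiRayEll T * (σ₂ - σ₁)) * xiStripScale T σ₁ *
        (60 / t + 2 + 5 * Real.exp 1 * (xiRayEll T + 1)) := by
  set δ := σ₂ - σ₁ with hδ
  have hδ0 : 0 ≤ δ := by linarith
  have hδ1 : δ ≤ 1 := by linarith
  set B := xiStripScale T σ₁ with hB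
  have hB0 : 0 ≤ B := xiStripScale_nonneg (by linarith) σ₁
  have h2π : 2 * π ≤ T := by linarith [Real.pi_lt_d2]
  have hℓ0 : 0 ≤ xiRayEll T := xiRayEll_nonneg h2π
  set κ := xiLogDerivModel T with hκ
  have hN := norm_xiHeatRayInit_sub_le ht hT h0 h12 h1
  have hN1 := norm_xiHeatRayInit_le ht hT (σ := σ₁) ⟨h0, by linarith⟩
  -- `‖1 − e^{κδ}‖ ≤ (ℓ+1) δ e^{(ℓ+1)δ} ≤ (ℓ+1) δ e^{ℓδ} e`
  have hexp : ‖cexp (κ * (δ : ℝ)) - 1‖ ≤ (xiRayEll T + 1) * δ * (Real.exp (xiRayEll T * δ) * Real.exp 1) := by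
    refine (norm_cexp_sub_one_le_mul_exp _).trans ?_
    have hn : ‖κ * (δ : ℝ)‖ ≤ (xiRayEll T + 1) * δ := by
      rw [norm_mul, Complex.norm_real, Real.norm_eq_abs, abs_of_nonneg hδ0]
      exact mul_le_mul_of_nonneg_right (norm_xiLogDerivModel_le h2π) hδ0
    have he : Real.exp ‖κ * (δ : ℝ)‖ ≤ Real.exp (xiRayEll T * δ) * Real.exp 1 := by
      rw [← Real.exp_add]
      apply Real.exp_le_exp.2
      calc ‖κ * (δ : ℝ)‖ ≤ (xiRayEll T + 1) * δ := hn
        _ = xiRayEll T * δ + δ := by ring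
        _ ≤ xiRayEll T * δ + 1 := by linarith
    exact mul_le_mul hn he (by positivity) (by positivity)
  have hsplit : xiHeatRayInit t T σ₂ - cexp (κ * (δ : ℝ)) * xiHeatRayInit t T σ₁ =
      (xiHeatRayInit t T σ₂ - xiHeatRayInit t T σ₁) - (cexp (κ * (δ : ℝ)) - 1) * xiHeatRayInit t T σ₁ := by
    ring
  rw [hsplit]
  have hexp1 : 1 ≤ Real.exp (xiRayEll T * δ) := Real.one_le_exp (by positivity)
  calc ‖(xiHeatRayInit t T σ₂ - xiHeatRayInit t T σ₁) - (cexp (κ * (δ : ℝ)) - 1) * xiHeatRayInit t T σ₁‖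
      ≤ ‖xiHeatRayInit t T σ₂ - xiHeatRayInit t T σ₁‖ + ‖cexp (κ * (δ : ℝ)) - 1‖ * ‖xiHeatRayInit t T σ₁‖ := by
        rw [← norm_mul]; exact norm_sub_le _ _
    _ ≤ δ * (60 / t + 2) * B + (xiRayEll T + 1) * δ * (Real.exp (xiRayEll T * δ) * Real.exp 1) * (5 * B) := by
        gcongr
    _ ≤ δ * (60 / t + 2) * B * Real.exp (xiRayEll T * δ) +
        (xiRayEll T + 1) * δ * (Real.exp (xiRayEll T * δ) * Real.exp 1) * (5 * B) := by
        have := le_mul_of_one_le_right (by positivity : 0 ≤ δ * (60 / t + 2) * B) hexp1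
        linarith
    _ = δ * Real.exp (xiRayEll T * δ) * B * (60 / t + 2 + 5 * Real.exp 1 * (xiRayEll T + 1)) := by ring

end Literature.NumberTheory.LFunctions

end
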